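import Literature.Combinatorics.StablePolynomials.RayleighOfStable
import Literature.Combinatorics.StablePolynomials.Limits
import HarnessLib

/-!
# Brändén's characterisation of real stable multi-affine polynomials (Brändén 2007, Thm. 5.6):
# the discharge of `Branden2007_multiAffine_rayleighDiff_nonneg_iff_realStable`

Topic `Literature/Combinatorics/StablePolynomials`, namespace `Literature.Combinatorics.StablePolynomials`; lane
`lit-hodgefound` (Track 2 foundations library), seat p16, generation 30 (row g30-#3). The named fact
`Branden2007_multiAffine_rayleighDiff_nonneg_iff_realStable` of `Basic.lean` — "for a real multi-affine
`f ∈ ℝ[z₁,…,zₙ]`, `f ≠ 0`: (1) `Δᵢⱼ(f)(x) ≥ 0` for all `x ∈ ℝⁿ` and all `i, j` ⟺ (2) `f` is stable" — is PROVED here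
(`Branden2007_multiAffine_rayleighDiff_nonneg_iff_realStable_holds`). Direction (2) ⇒ (1) is the tree's
`rayleighDiff_nonneg_of_isRealStable` (`RayleighOfStable.lean`); direction (1) ⇒ (2) is new.

## Source (verbatim) — P. Brändén, *Polynomials with the half-plane property and matroid theory*, Adv. Math. 216
## (2007) 302–320 [Branden2007] (held `paper:arxiv-math_0605678`), §5

"Two multivariate polynomials `g, h ∈ ℝ[z₁, …, zₙ]` are said to be in proper position, denoted `g ≪ h`, if
`g(α + vt) ≪ h(α + vt)` for all `α ∈ ℝⁿ` and `v ∈ ℝⁿ₊`." **Corollary 5.5.** "Let `f = h + ig ≠ 0` where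
`h, g ∈ ℝ[z₁,…,zₙ]`, and let `z_{n+1}` be a new indeterminate. Then the following are equivalent. (a) `f = h + ig` is
stable, (b) `h + z_{n+1} g` is real stable, (c) all nonzero polynomials in the pencil `{αh + βg : α, β ∈ ℝ}` are real
stable and `∂h/∂zⱼ(x)·g(x) - h(x)·∂g/∂zⱼ(x) ≥ 0` for all `1 ≤ j ≤ n` and `x ∈ ℝⁿ`." Proof of (c) ⇒ (b): "Fixing
`z_{n+1} = a + ib`, we have to prove that `h + (a + ib)g = (h + ag) + ibg` is stable whenever `a ∈ ℝ` and `b ∈ ℝ₊`.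
[…] by Theorem 5.4 (Obreschkoff, several variables) `h + ag ≪ bg` or `bg ≪ h + ag`. Now,
`W(bg(α+vt), h(α+vt) + ag(α+vt)) = -b Σⱼ vⱼ (∂h/∂zⱼ·g - h·∂g/∂zⱼ)(α + vt) ≤ 0` […]. The conclusion now follows from
Theorem 5.3 (Hermite–Biehler, several variables)". **Theorem 5.6.** "Let `f ∈ ℝ[z₁,…,zₙ]` be multi-affine. Then
the following are equivalent (1) For all `x ∈ ℝⁿ` and `1 ≤ i,j ≤ n`, `Δᵢⱼ(f)(x) ≥ 0`, (2) `f` is stable." Proof of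
(1) ⇒ (2): "The proof is by induction over `n`. Write `f ∈ ℝ[z₁, …, z_{n+1}]` as `f = h + z_{n+1}g`. We want to apply
Corollary 5.5, (c) ⇒ (b). Let `α ∈ ℝ`, `x ∈ ℝⁿ` and `1 ≤ i,j ≤ n`. Then
`Δᵢⱼ(f|_{z_{n+1}=α})(x) = Δᵢⱼ(f)(x₁, …, xₙ, α) ≥ 0`. By induction `h + αg` is real stable or `h + αg = 0`. This
verifies the condition about the pencil in Corollary 5.5 (c). Also,
`∂h/∂zⱼ(x)·g(x) - h(x)·∂g/∂zⱼ(x) = Δ_{j,n+1}(f)(x) ≥ 0` for all `x ∈ ℝⁿ` and `1 ≤ j ≤ n`. This verifies the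
Wronskian condition in Corollary 5.5 (c) which completes the proof."

## The one deviation from the printed proof

The tree does not contain the multivariate Hermite–Biehler and Obreschkoff theorems (Thms. 5.3, 5.4, from [BBS2]),
through which Cor. 5.5 (c) ⇒ (b) is proved in print. The special case of (c) ⇒ (b) that Theorem 5.6 consumes — the
pencil condition in the form "`h` real stable, `g` real stable or zero, every `h - γg` (`γ ∈ ℝ`) real stable or zero"
plus the Wronskian condition, conclusion "`h(z) + w g(z) ≠ 0` for `z ∈ ℋⁿ`, `Im w > 0`" — is proved here
(`eval_add_mul_eval_ne_zero`) by an elementary argument along the positive line through `z`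
(`t ↦ x + tv`, `x = Re z`, `v = Im z`, `t = i ↦ z`), which is where the printed proof also works: on the upper
half-plane `φ = h/g` is holomorphic and never real (a real value `γ` at `t ∈ ℋ` would be a zero of the real stable
`h - γg` in `ℋⁿ`), so `Im φ` has constant sign there (intermediate values along segments); at a real point `x₀` the
Wronskian condition reads `φ'(x₀) = W(x₀)/g(x₀)² ≥ 0`, and `Im φ(x₀ + iy) = y φ'(x₀) + o(y)`; choosing `x₀` with
`W(x₀) ≠ 0` forces `Im φ > 0` somewhere, hence everywhere, on `ℋ` — while `W ≡ 0` forces `φ` to be constant on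
`ℋ`, with a real boundary value. Either way `φ(z) ≠ -w`.

## What is here

* §1 `linePoly q x v` (the univariate polynomial `t ↦ q(x + tv)`), `eval_linePoly`, **`derivative_linePoly`**
  (chain rule `d/dt q(x + tv) = Σⱼ vⱼ (∂ⱼq)(x + tv)`), `eval_map_line_ofReal` (real points of a positive line).
* §2 **`eval_add_mul_eval_ne_zero`** — Cor. 5.5 (c) ⇒ (b) in the form used by Theorem 5.6.
* §3 the distinguished-variable decomposition of a multi-affine `f ∈ ℝ[z_τ, z_{none}]`: `f(s, y) = h(s) + y g(s)`
  with `h = [z_{none}^0] f`, `g = [z_{none}^1] f` (`optionEquivLeft`), their multi-affinity, and the identities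
  `Δᵢⱼ(f)(x, γ) = Δᵢⱼ(h + γg)(x)`, `Δ_{j,none}(f)(x, γ) = (∂ⱼh·g - h·∂ⱼg)(x)`.
* §4 **Theorem 5.6 (1) ⇒ (2)** `isRealStable_of_rayleighDiff_nonneg_of_isMultiAffine` (induction over the finite
  type of variables, `Fintype.induction_empty_option`), and the discharge
  **`Branden2007_multiAffine_rayleighDiff_nonneg_iff_realStable_holds`**.

Theorems only, plus the plumbing definition `linePoly` (no named fact; net debt -1).

## References

* [Branden2007] P. Brändén, *Polynomials with the half-plane property and matroid theory*, Adv. Math. 216 (2007)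
  302–320, arXiv:math/0605678 — §5: Cor. 5.5, Thm. 5.6 and their proofs.
* [BorceaBranden2009] J. Borcea, P. Brändén, *The Lee–Yang and Pólya–Schur programs. I*, Invent. Math. 177
  (2009) — §1 (real stability), the convention of `Basic.lean`.
-/

noncomputable section

open scoped BigOperators Topology Polynomial
open MvPolynomial Filter Set

namespace Literature.Combinatorics.StablePolynomials

variable {τ : Type*}

/-! ## §1 Restriction of a polynomial to a line `t ↦ x + tv` -/

section Line

/-- **The restriction of `q` to the complex line `t ↦ x + tv`** as a univariate polynomial in `t` (Brändén's
`g(α + vt)`, `h(α + vt)`). [cite: Branden2007, §5 (definition of proper position in several variables,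
"`g(α + vt) ≪ h(α + vt)` for all `α ∈ ℝⁿ` and `v ∈ ℝⁿ₊`")] -/
def linePoly (q : MvPolynomial τ ℂ) (x v : τ → ℂ) : ℂ[X] :=
  MvPolynomial.aeval (fun j => Polynomial.C (x j) + Polynomial.X * Polynomial.C (v j)) q

/-- `linePoly` of a constant. [cite: Branden2007, §5 (proper position in several variables)] -/
@[simp]
theorem linePoly_C (a : ℂ) (x v : τ → ℂ) : linePoly (C a) x v = Polynomial.C a := by
  simp [linePoly]

/-- `linePoly` of a variable: the affine function `xⱼ + t vⱼ`. [cite: Branden2007, §5] -/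
@[simp]
theorem linePoly_X (j : τ) (x v : τ → ℂ) :
    linePoly (X j) x v = Polynomial.C (x j) + Polynomial.X * Polynomial.C (v j) := by
  simp [linePoly]

/-- `linePoly` is additive. [cite: Branden2007, §5] -/
@[simp]
theorem linePoly_add (p q : MvPolynomial τ ℂ) (x v : τ → ℂ) :
    linePoly (p + q) x v = linePoly p x v + linePoly q x v := by
  simp [linePoly]

/-- `linePoly` is multiplicative. [cite: Branden2007, §5] -/
@[simp]
theorem linePoly_mul (p q : MvPolynomial τ ℂ) (x v : τ → ℂ) :
    linePoly (p * q) x v = linePoly p x v * linePoly q x v := by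
  simp [linePoly]

/-- `linePoly 0 = 0`. [cite: Branden2007, §5] -/
@[simp]
theorem linePoly_zero (x v : τ → ℂ) : linePoly (0 : MvPolynomial τ ℂ) x v = 0 := by
  simp [linePoly]

/-- `(linePoly q x v)(t) = q(x + tv)`. [cite: Branden2007, §5 (proper position in several variables)] -/
theorem eval_linePoly (q : MvPolynomial τ ℂ) (x v : τ → ℂ) (t : ℂ) :
    (linePoly q x v).eval t = eval (fun j => x j + t * v j) q := by
  induction q using MvPolynomial.induction_on with
  | C a => simp
  | add p q hp hq => rw [linePoly_add, Polynomial.eval_add, hp, hq, map_add]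
  | mul_X p i hp =>
    rw [linePoly_mul, linePoly_X, Polynomial.eval_mul, hp, map_mul, eval_X]
    simp only [Polynomial.eval_add, Polynomial.eval_C, Polynomial.eval_mul, Polynomial.eval_X]

/-- **Chain rule along a line**: `d/dt q(x + tv) = Σⱼ vⱼ (∂ⱼ q)(x + tv)`, as polynomials in `t`.
[cite: Branden2007, §5 proof of Cor. 5.5 ("`W(g(x + eⱼt), h(x + eⱼt))|_{t=0}`", the Wronskian along a line)] -/
theorem derivative_linePoly [Fintype τ] [DecidableEq τ] (q : MvPolynomial τ ℂ) (x v : τ → ℂ) :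
    Polynomial.derivative (linePoly q x v) = ∑ j, Polynomial.C (v j) * linePoly (pderiv j q) x v := by
  induction q using MvPolynomial.induction_on with
  | C a => simp
  | add p q hp hq =>
    simp only [linePoly_add, map_add, hp, hq, ← Finset.sum_add_distrib, mul_add]
  | mul_X p i hp =>
    have hXi : ∑ j, Polynomial.C (v j) * linePoly (pderiv j (X i : MvPolynomial τ ℂ)) x v =
        Polynomial.C (v i) := by
      rw [Finset.sum_eq_single i]
      · rw [pderiv_X_self, ← C_1, linePoly_C, map_one, mul_one]
      · intro j _ hji
        rw [pderiv_X_of_ne hji.symm, linePoly_zero, mul_zero]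
      · intro hi
        exact absurd (Finset.mem_univ i) hi
    set ℓ : ℂ[X] := Polynomial.C (x i) + Polynomial.X * Polynomial.C (v i) with hℓdef
    have hℓ : Polynomial.derivative ℓ = Polynomial.C (v i) := by
      simp [hℓdef]
    have hLX : linePoly (X i) x v = ℓ := linePoly_X i x v
    have hR : ∀ j, linePoly (pderiv j (p * X i)) x v =
        linePoly (pderiv j p) x v * ℓ + linePoly p x v * linePoly (pderiv j (X i)) x v := by
      intro j
      rw [pderiv_mul, linePoly_add, linePoly_mul, linePoly_mul, hLX]
    rw [linePoly_mul, hLX, Polynomial.derivative_mul, hp, hℓ]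
    simp only [hR, mul_add, Finset.sum_add_distrib]
    congr 1
    · rw [Finset.sum_mul]
      exact Finset.sum_congr rfl fun j _ => by ring
    · rw [← hXi, Finset.mul_sum]
      exact Finset.sum_congr rfl fun j _ => by ring

/-- The real points of the positive line through `z ∈ ℂⁿ`: `Re z + s Im z` for real `s`. [folklore] -/
private theorem line_ofReal (z : τ → ℂ) (s : ℝ) :
    (fun j => ((z j).re : ℂ) + (s : ℂ) * ((z j).im : ℂ)) = fun j => (((z j).re + s * (z j).im : ℝ) : ℂ) := by
  funext j
  push_cast
  ring

/-- A real polynomial takes real values at the real points of a line.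
[cite: Branden2007, §5 (proper position: "for all `α ∈ ℝⁿ` and `v ∈ ℝⁿ₊`")] -/
theorem eval_map_line_ofReal (q : MvPolynomial τ ℝ) (z : τ → ℂ) (s : ℝ) :
    eval (fun j => ((z j).re : ℂ) + (s : ℂ) * ((z j).im : ℂ)) (map (algebraMap ℝ ℂ) q) =
      ((eval (fun j => (z j).re + s * (z j).im) q : ℝ) : ℂ) := by
  rw [line_ofReal, eval_map_algebraMap_ofReal]

/-- A positive line stays in `ℋⁿ` exactly over the upper half-plane: `Im (Re zⱼ + t Im zⱼ) = Im t · Im zⱼ`.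
[folklore] -/
private theorem im_line (z : τ → ℂ) (t : ℂ) (j : τ) :
    (((z j).re : ℂ) + t * ((z j).im : ℂ)).im = t.im * (z j).im := by
  simp [Complex.add_im, Complex.mul_im]

end Line

/-! ## §2 Corollary 5.5 (c) ⇒ (b), in the form used by Theorem 5.6 -/

section Core

variable [Fintype τ]

/-- **Corollary 5.5, (c) ⇒ (b) (the form consumed by Theorem 5.6).** Let `h, g ∈ ℝ[z₁,…,zₙ]` with `h` real stable,
`g` real stable or zero, every `h + γg` (`γ ∈ ℝ`) real stable or zero ("all nonzero polynomials in the pencil are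
real stable"), and `∂ⱼh(x)·g(x) - h(x)·∂ⱼg(x) ≥ 0` for all real `x` and all `j` (the Wronskian condition). Then
`h(z) + w·g(z) ≠ 0` for every `z ∈ ℋⁿ` and `Im w > 0` — i.e. `h + z_{n+1} g` is real stable. Proved along the
positive line `t ↦ Re z + t Im z` (see the module docstring for the elementary replacement of Hermite–Biehler /
Obreschkoff). [cite: Branden2007, §5 Cor. 5.5 ((c) ⇒ (b)) and its proof] -/
theorem eval_add_mul_eval_ne_zero {h g : MvPolynomial τ ℝ} (hh : IsRealStable h)
    (hg : g = 0 ∨ IsRealStable g) (hpencil : ∀ γ : ℝ, h + C γ * g = 0 ∨ IsRealStable (h + C γ * g))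
    (hW : ∀ (y : τ → ℝ) (j : τ), 0 ≤ eval y (pderiv j h * g - h * pderiv j g))
    {z : τ → ℂ} (hz : ∀ j, 0 < (z j).im) {w : ℂ} (hw : 0 < w.im) :
    eval z (map (algebraMap ℝ ℂ) h) + w * eval z (map (algebraMap ℝ ℂ) g) ≠ 0 := by
  classical
  intro H0
  set hc := map (algebraMap ℝ ℂ) h with hhc
  set gc := map (algebraMap ℝ ℂ) g with hgc
  -- `g = 0` is immediate
  rcases hg with rfl | hgst
  · rw [hgc, map_zero, map_zero, mul_zero, add_zero] at H0
    exact hh z hz H0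
  have hGz : eval z gc ≠ 0 := hgst z hz
  -- `h = -γ g` is immediate: `(w - γ) g(z) ≠ 0`
  by_cases hprop : ∃ γ : ℝ, h + C γ * g = 0
  · obtain ⟨γ, hγ⟩ := hprop
    have hhg : hc = -(C (γ : ℂ) * gc) := by
      rw [hhc, eq_neg_of_add_eq_zero_left hγ, map_neg, map_mul, map_C]
      rfl
    rw [hhg, map_neg, map_mul, eval_C, neg_add_eq_sub, ← sub_mul] at H0
    rcases mul_eq_zero.1 H0 with h1 | h1
    · have := congrArg Complex.im h1
      simp at this
      exact hw.ne' this
    · exact hGz h1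
  have hpencil' : ∀ γ : ℝ, IsRealStable (h + C γ * g) := fun γ =>
    (hpencil γ).resolve_left fun h0 => hprop ⟨γ, h0⟩
  -- the positive line through `z`
  set x : τ → ℂ := fun j => ((z j).re : ℂ) with hx
  set v : τ → ℂ := fun j => ((z j).im : ℂ) with hv
  set Fp := linePoly hc x v with hFp
  set Gp := linePoly gc x v with hGp
  have hF : ∀ t, Fp.eval t = eval (fun j => ((z j).re : ℂ) + t * ((z j).im : ℂ)) hc := fun t =>
    eval_linePoly hc x v t
  have hG : ∀ t, Gp.eval t = eval (fun j => ((z j).re : ℂ) + t * ((z j).im : ℂ)) gc := fun t =>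
    eval_linePoly gc x v t
  have hmem : ∀ t : ℂ, 0 < t.im → ∀ j, 0 < (((z j).re : ℂ) + t * ((z j).im : ℂ)).im := by
    intro t ht j
    rw [im_line]
    exact mul_pos ht (hz j)
  have hI : (fun j => ((z j).re : ℂ) + Complex.I * ((z j).im : ℂ)) = z := by
    funext j
    rw [mul_comm]
    exact Complex.re_add_im (z j)
  have hFI : Fp.eval Complex.I = eval z hc := by rw [hF, hI]
  have hGI : Gp.eval Complex.I = eval z gc := by rw [hG, hI]
  have hGne : ∀ t : ℂ, 0 < t.im → Gp.eval t ≠ 0 := fun t ht => by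
    rw [hG]
    exact hgst _ (hmem t ht)
  have hGp0 : Gp ≠ 0 := fun h0 => hGne Complex.I (by simp) (by rw [h0, Polynomial.eval_zero])
  -- `φ = F/G` on the upper half-plane; at `i` it equals `-w`
  have hφI : Fp.eval Complex.I / Gp.eval Complex.I = -w := by
    rw [hFI, hGI, div_eq_iff hGz]
    linear_combination H0
  -- Step 1: `φ` is never real on `ℋ`
  have hstep1 : ∀ t : ℂ, 0 < t.im → (Fp.eval t / Gp.eval t).im ≠ 0 := by
    intro t ht him
    set γ := (Fp.eval t / Gp.eval t).re with hγ
    have hφ : Fp.eval t / Gp.eval t = (γ : ℂ) := Complex.ext (by simp [hγ]) (by simpa using him)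
    have hFG : Fp.eval t = (γ : ℂ) * Gp.eval t := by
      rw [← hφ, div_mul_cancel₀ _ (hGne t ht)]
    refine hpencil' (-γ) _ (hmem t ht) ?_
    rw [map_add, map_mul, map_C, map_add, map_mul, eval_C, ← hhc, ← hgc, ← hF, ← hG, hFG]
    simp
  -- Step 2: `Im φ < 0` on all of `ℋ` (it is `< 0` at `i`; intermediate values along segments)
  have hstep2 : ∀ t : ℂ, 0 < t.im → (Fp.eval t / Gp.eval t).im < 0 := by
    intro t ht
    -- the segment from `i` to `t`
    let p : ℝ → ℂ := fun s => Complex.I + (s : ℂ) * (t - Complex.I)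
    have hp_im : ∀ s : ℝ, (p s).im = (1 - s) + s * t.im := by
      intro s
      simp [p, Complex.add_im, Complex.mul_im]
      ring
    have hp_mem : ∀ s ∈ Icc (0 : ℝ) 1, 0 < (p s).im := by
      intro s hs
      rw [hp_im]
      rcases hs with ⟨h0, h1⟩
      calc (0 : ℝ) < min 1 t.im := lt_min one_pos ht
        _ ≤ (1 - s) + s * t.im := by
          nlinarith [min_le_left (1 : ℝ) t.im, min_le_right (1 : ℝ) t.im,
            mul_nonneg (sub_nonneg.2 h1) (sub_nonneg.2 (min_le_left (1 : ℝ) t.im)),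
            mul_nonneg h0 (sub_nonneg.2 (min_le_right (1 : ℝ) t.im))]
    let ψ : ℝ → ℝ := fun s => (Fp.eval (p s) / Gp.eval (p s)).im
    have hψcont : ContinuousOn ψ (Icc 0 1) := by
      have hpc : Continuous p := by
        simp only [p]
        fun_prop
      refine Complex.continuous_im.comp_continuousOn (ContinuousOn.div ?_ ?_ fun s hs => hGne _ (hp_mem s hs))
      · exact ((Polynomial.continuous Fp).comp hpc).continuousOn
      · exact ((Polynomial.continuous Gp).comp hpc).continuousOn
    have hψ0 : ψ 0 < 0 := by
      simp only [ψ, p, Complex.ofReal_zero, zero_mul, add_zero, hφI, Complex.neg_im]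
      linarith
    have hψ1 : ψ 1 = (Fp.eval t / Gp.eval t).im := by
      simp [ψ, p]
    rw [← hψ1]
    by_contra hge
    have h01 : (0 : ℝ) ∈ Icc (ψ 0) (ψ 1) := ⟨hψ0.le, not_lt.1 hge⟩
    obtain ⟨s, hs, hs0⟩ := intermediate_value_Icc zero_le_one hψcont h01
    exact hstep1 (p s) (hp_mem s hs) hs0
  -- Step 3: a real point `x₀` with `g(x₀) ≠ 0` off the zero set of the Wronskian polynomial
  set Wp := Polynomial.derivative Fp * Gp - Fp * Polynomial.derivative Gp with hWp
  obtain ⟨x₀, hx₀⟩ := Infinite.exists_notMem_finset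
    ((Gp.roots.toFinset ∪ Wp.roots.toFinset).preimage ((↑) : ℝ → ℂ) Complex.ofReal_injective.injOn)
  rw [Finset.mem_preimage, Finset.mem_union, Multiset.mem_toFinset, Multiset.mem_toFinset, not_or] at hx₀
  have hGx₀ : Gp.eval (x₀ : ℂ) ≠ 0 := fun h0 => hx₀.1 ((Polynomial.mem_roots hGp0).2 h0)
  have hWx₀ : Wp = 0 ∨ Wp.eval (x₀ : ℂ) ≠ 0 := by
    by_cases hW0 : Wp = 0
    · exact Or.inl hW0
    · exact Or.inr fun h0 => hx₀.2 ((Polynomial.mem_roots hW0).2 h0)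
  -- the real number `W(x₀) = Σⱼ Im zⱼ · (∂ⱼh g - h ∂ⱼg)(Re z + x₀ Im z) ≥ 0`
  set y₀ : τ → ℝ := fun j => (z j).re + x₀ * (z j).im with hy₀
  have hWeval : ∀ s : ℝ, Wp.eval (s : ℂ) =
      ((∑ j, (z j).im * eval (fun k => (z k).re + s * (z k).im) (pderiv j h * g - h * pderiv j g) : ℝ) : ℂ) := by
    intro s
    rw [hWp, Polynomial.eval_sub, Polynomial.eval_mul, Polynomial.eval_mul, hFp, hGp,
      derivative_linePoly, derivative_linePoly, Polynomial.eval_finsetSum, Polynomial.eval_finsetSum]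
    simp only [Polynomial.eval_mul, Polynomial.eval_C, eval_linePoly, hhc, hgc, pderiv_map]
    rw [Finset.sum_mul, Finset.mul_sum, ← Finset.sum_sub_distrib]
    push_cast
    refine Finset.sum_congr rfl fun j _ => ?_
    have e1 := eval_map_line_ofReal (pderiv j h) z s
    have e2 := eval_map_line_ofReal g z s
    have e3 := eval_map_line_ofReal h z s
    have e4 := eval_map_line_ofReal (pderiv j g) z s
    simp only [hx, hv] at e1 e2 e3 e4 ⊢
    rw [e1, e2, e3, e4]
    simp only [map_sub, map_mul]
    push_cast
    ring
  have hWnn : ∀ s : ℝ, 0 ≤ ∑ j, (z j).im * eval (fun k => (z k).re + s * (z k).im)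
      (pderiv j h * g - h * pderiv j g) := fun s =>
    Finset.sum_nonneg fun j _ => mul_nonneg (hz j).le (hW _ j)
  -- `g(x₀)`, `h(x₀)` are real
  have hGreal : Gp.eval (x₀ : ℂ) = ((eval y₀ g : ℝ) : ℂ) := by
    rw [hG, hgc, eval_map_line_ofReal]
  have hFreal : Fp.eval (x₀ : ℂ) = ((eval y₀ h : ℝ) : ℂ) := by
    rw [hF, hhc, eval_map_line_ofReal]
  have hgy₀ : eval y₀ g ≠ 0 := fun h0 => hGx₀ (by rw [hGreal, h0, Complex.ofReal_zero])
  -- the derivative of `φ = F/G`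
  have hderiv : ∀ t : ℂ, Gp.eval t ≠ 0 →
      HasDerivAt (fun t => Fp.eval t / Gp.eval t) (Wp.eval t / (Gp.eval t) ^ 2) t := by
    intro t ht
    rw [hWp, Polynomial.eval_sub, Polynomial.eval_mul, Polynomial.eval_mul]
    exact (Polynomial.hasDerivAt Fp t).fun_div (Polynomial.hasDerivAt Gp t) ht
  rcases hWx₀ with hW0 | hW1
  · -- Step 3c: `W ≡ 0`: `φ` is constant `= -w` on `ℋ`, but has the real boundary value `φ(x₀)`
    have hconst : ∀ t : ℂ, 0 < t.im → Fp.eval t / Gp.eval t = -w := by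
      intro t ht
      have hconv : Convex ℝ {s : ℂ | 0 < s.im} :=
        convex_halfSpace_gt ⟨fun _ _ => Complex.add_im _ _, fun c x => Complex.smul_im c x⟩ 0
      have key := hconv.norm_image_sub_le_of_norm_hasDerivWithin_le
        (f := fun t => Fp.eval t / Gp.eval t) (f' := fun _ => (0 : ℂ)) (C := 0)
        (fun s hs => by
          have hd := hderiv s (hGne s hs)
          rw [hW0, Polynomial.eval_zero, zero_div] at hd
          exact hd.hasDerivWithinAt)
        (fun _ _ => by simp) (show Complex.I ∈ {s : ℂ | 0 < s.im} by simp) ht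
      rw [zero_mul, norm_le_zero_iff, sub_eq_zero] at key
      rw [key, hφI]
    -- limit along `x₀ + iy`, `y → 0⁺`
    have hpath : Tendsto (fun y : ℝ => (x₀ : ℂ) + Complex.I * y) (𝓝[>] 0) (𝓝 (x₀ : ℂ)) := by
      have : Continuous fun y : ℝ => (x₀ : ℂ) + Complex.I * y := by fun_prop
      have h := this.tendsto 0
      simp only [Complex.ofReal_zero, mul_zero, add_zero] at h
      exact h.mono_left nhdsWithin_le_nhds
    have hcontφ : ContinuousAt (fun t => Fp.eval t / Gp.eval t) (x₀ : ℂ) :=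
      ((Polynomial.continuous Fp).continuousAt).div ((Polynomial.continuous Gp).continuousAt) hGx₀
    have hlim1 : Tendsto (fun y : ℝ => Fp.eval ((x₀ : ℂ) + Complex.I * y) / Gp.eval ((x₀ : ℂ) + Complex.I * y))
        (𝓝[>] 0) (𝓝 (Fp.eval (x₀ : ℂ) / Gp.eval (x₀ : ℂ))) := hcontφ.tendsto.comp hpath
    have hlim2 : Tendsto (fun y : ℝ => Fp.eval ((x₀ : ℂ) + Complex.I * y) / Gp.eval ((x₀ : ℂ) + Complex.I * y))
        (𝓝[>] 0) (𝓝 (-w)) := by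
      refine tendsto_const_nhds.congr' ?_
      filter_upwards [self_mem_nhdsWithin] with y hy
      exact (hconst _ (by simpa using hy)).symm
    have heq : Fp.eval (x₀ : ℂ) / Gp.eval (x₀ : ℂ) = -w := tendsto_nhds_unique hlim1 hlim2
    have := congrArg Complex.im heq
    rw [hFreal, hGreal, ← Complex.ofReal_div, Complex.ofReal_im, Complex.neg_im] at this
    linarith
  · -- Step 3b: `W(x₀) > 0`: `Im φ(x₀ + iy) > 0` for small `y > 0`
    have hWpos : 0 < ∑ j, (z j).im * eval (fun k => (z k).re + x₀ * (z k).im) (pderiv j h * g - h * pderiv j g) := by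
      refine lt_of_le_of_ne (hWnn x₀) fun h0 => hW1 ?_
      rw [hWeval, ← h0, Complex.ofReal_zero]
    set r : ℝ := (∑ j, (z j).im * eval (fun k => (z k).re + x₀ * (z k).im) (pderiv j h * g - h * pderiv j g)) /
      (eval y₀ g) ^ 2 with hr
    have hg2 : 0 < (eval y₀ g) ^ 2 := lt_of_le_of_ne (sq_nonneg _) (Ne.symm (pow_ne_zero 2 hgy₀))
    have hrpos : 0 < r := div_pos hWpos hg2
    have hd : HasDerivAt (fun t => Fp.eval t / Gp.eval t) (r : ℂ) (x₀ : ℂ) := by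
      have hd₀ := hderiv (x₀ : ℂ) hGx₀
      rw [hWeval, hGreal, ← Complex.ofReal_pow, ← Complex.ofReal_div] at hd₀
      exact hd₀
    -- slopes along `x₀ + iy`, `y → 0⁺`
    have hpath : Tendsto (fun y : ℝ => Complex.I * y) (𝓝[>] (0 : ℝ)) (𝓝[≠] (0 : ℂ)) := by
      refine tendsto_nhdsWithin_of_tendsto_nhds_of_eventually_within _ ?_ ?_
      · have : Continuous fun y : ℝ => Complex.I * y := by fun_prop
        have h := this.tendsto 0
        simp only [Complex.ofReal_zero, mul_zero] at h
        exact h.mono_left nhdsWithin_le_nhds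
      · filter_upwards [self_mem_nhdsWithin] with y hy
        simpa using ne_of_gt hy
    have hslope := hd.tendsto_slope_zero.comp hpath
    have hre : Tendsto (fun y : ℝ => ((Complex.I * y)⁻¹ •
        (Fp.eval ((x₀ : ℂ) + Complex.I * y) / Gp.eval ((x₀ : ℂ) + Complex.I * y) -
          Fp.eval (x₀ : ℂ) / Gp.eval (x₀ : ℂ))).re) (𝓝[>] (0 : ℝ)) (𝓝 r) := by
      have := (Complex.continuous_re.tendsto _).comp hslope
      simpa only [Function.comp_def, Complex.ofReal_re] using this
    obtain ⟨y, hyre, hy⟩ := ((hre.eventually_const_lt hrpos).and self_mem_nhdsWithin).exists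
    have hy' : (0 : ℝ) < y := hy
    -- the real part of the slope is `Im φ(x₀ + iy) / y`
    have hφreal : (Fp.eval (x₀ : ℂ) / Gp.eval (x₀ : ℂ)).im = 0 := by
      rw [hFreal, hGreal, ← Complex.ofReal_div, Complex.ofReal_im]
    have hcomp : ∀ a : ℂ, ((Complex.I * y)⁻¹ • a).re = y⁻¹ * a.im := by
      intro a
      rw [smul_eq_mul, mul_inv, Complex.inv_I, ← Complex.ofReal_inv,
        show -Complex.I * ((y⁻¹ : ℝ) : ℂ) * a = ((y⁻¹ : ℝ) : ℂ) * (-(Complex.I * a)) by ring,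
        Complex.re_ofReal_mul, Complex.neg_re, Complex.I_mul_re, neg_neg]
    rw [hcomp, Complex.sub_im, hφreal, sub_zero] at hyre
    have him_pos : 0 < (Fp.eval ((x₀ : ℂ) + Complex.I * y) / Gp.eval ((x₀ : ℂ) + Complex.I * y)).im := by
      have := mul_pos hy' hyre
      rwa [← mul_assoc, mul_inv_cancel₀ hy'.ne', one_mul] at this
    have him_neg := hstep2 ((x₀ : ℂ) + Complex.I * y) (by simpa using hy')
    linarith

end Core

/-! ## §3 The distinguished-variable decomposition `f = h + z_{none} g` of a multi-affine polynomial -/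

section Decomposition

/-- `∂/∂z_{none}` kills the polynomials in the remaining variables. [folklore] -/
private theorem pderiv_none_rename_some {R : Type*} [CommRing R] (q : MvPolynomial τ R) :
    pderiv none (rename some q : MvPolynomial (Option τ) R) = 0 := by
  induction q using MvPolynomial.induction_on with
  | C a => rw [rename_C, pderiv_C]
  | add p q hp hq => rw [map_add, map_add, hp, hq, add_zero]
  | mul_X p j hp =>
    rw [map_mul, rename_X, pderiv_mul, hp, zero_mul, zero_add, pderiv_X_of_ne (Option.some_ne_none j),
      mul_zero]

/-- `optionEquivLeft` sends the polynomials in the remaining variables to constants. [folklore] -/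
private theorem optionEquivLeft_rename_some {R : Type*} [CommSemiring R] (q : MvPolynomial τ R) :
    optionEquivLeft R τ (rename some q) = Polynomial.C q := by
  induction q using MvPolynomial.induction_on with
  | C a => rw [rename_C, optionEquivLeft_C]
  | add p q hp hq => rw [map_add, map_add, hp, hq, Polynomial.C_add]
  | mul_X p j hp => rw [map_mul, rename_X, map_mul, hp, optionEquivLeft_X_some, ← Polynomial.C_mul]

/-- **`f = h + z_{none} g`** for a polynomial of degree `≤ 1` in the distinguished variable `z_{none}`, with
`h = [z_{none}^0] f` and `g = [z_{none}^1] f` polynomials in the remaining variables ("Write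
`f ∈ ℝ[z₁, …, z_{n+1}]` as `f = h + z_{n+1} g`"). [cite: Branden2007, §5 proof of Thm. 5.6] -/
theorem eq_rename_add_X_mul_rename {R : Type*} [CommSemiring R] {f : MvPolynomial (Option τ) R}
    (hf : f.degreeOf none ≤ 1) :
    f = rename some ((optionEquivLeft R τ f).coeff 0) +
      X none * rename some ((optionEquivLeft R τ f).coeff 1) := by
  set P := optionEquivLeft R τ f with hP
  have hdeg : P.natDegree ≤ 1 := by
    rw [hP, natDegree_optionEquivLeft]
    exact hf
  have hPeq := Polynomial.eq_X_add_C_of_natDegree_le_one hdeg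
  apply (optionEquivLeft R τ).injective
  rw [← hP, map_add, map_mul, optionEquivLeft_X_none, optionEquivLeft_rename_some, optionEquivLeft_rename_some]
  conv_lhs => rw [hPeq]
  ring

/-- The coefficients `h`, `g` of a multi-affine `f = h + z_{none} g` are multi-affine. [cite: Branden2007, §5 proof of
Thm. 5.6 (the induction hypothesis is applied to `h + αg`)] -/
theorem isMultiAffine_coeff_optionEquivLeft {R : Type*} [CommSemiring R] {f : MvPolynomial (Option τ) R}
    (hf : IsMultiAffine f) (k : ℕ) : IsMultiAffine ((optionEquivLeft R τ f).coeff k) := by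
  rw [isMultiAffine_iff_support] at hf ⊢
  intro m hm i
  rw [mem_support_iff, optionEquivLeft_coeff_coeff] at hm
  have := hf _ (mem_support_iff.2 hm) (some i)
  rwa [Finsupp.optionElim_apply_some] at this

/-- Evaluating `h + yg` and its derivatives at `(x, γ)`: for `f = h + z_{none} g` with `h, g` free of `z_{none}`,
`f(x, γ) = (h + γg)(x)`, `∂_{some i} f (x, γ) = ∂ᵢ(h + γg)(x)`, `∂_{none} f (x, γ) = g(x)`. [cite: Branden2007, §5
proof of Thm. 5.6 ("`Δᵢⱼ(f|_{z_{n+1}=α})(x) = Δᵢⱼ(f)(x₁, …, xₙ, α)`")] -/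
theorem eval_optionElim_of_eq {R : Type*} [CommRing R] {f : MvPolynomial (Option τ) R}
    {h g : MvPolynomial τ R} (hf : f = rename some h + X none * rename some g) (γ : R) (x : τ → R) :
    eval (fun o => Option.elim o γ x) f = eval x (h + C γ * g) ∧
    (∀ i, eval (fun o => Option.elim o γ x) (pderiv (some i) f) = eval x (pderiv i (h + C γ * g))) ∧
    (∀ i j, eval (fun o => Option.elim o γ x) (pderiv (some i) (pderiv (some j) f)) =
      eval x (pderiv i (pderiv j (h + C γ * g)))) ∧
    eval (fun o => Option.elim o γ x) (pderiv none f) = eval x g ∧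
    (∀ j, eval (fun o => Option.elim o γ x) (pderiv (some j) (pderiv none f)) = eval x (pderiv j g)) := by
  have hsome : ((fun o => Option.elim o γ x) ∘ some : τ → R) = x := funext fun _ => rfl
  have hinj : Function.Injective (some : τ → Option τ) := Option.some_injective τ
  have hnone : pderiv none f = rename some g := by
    rw [hf, map_add, pderiv_none_rename_some, zero_add, pderiv_mul, pderiv_X_self, one_mul,
      pderiv_none_rename_some, mul_zero, add_zero]
  have hsi : ∀ i, pderiv (some i) f = rename some (pderiv i h) + X none * rename some (pderiv i g) := by
    intro i
    rw [hf, map_add, pderiv_rename hinj, pderiv_mul, pderiv_X_of_ne (Option.some_ne_none i).symm, zero_mul,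
      zero_add, pderiv_rename hinj]
  refine ⟨?_, fun i => ?_, fun i j => ?_, ?_, fun j => ?_⟩
  · rw [hf]
    simp only [map_add, map_mul, eval_X, eval_rename, hsome, eval_C, Option.elim_none]
  · rw [hsi]
    simp only [map_add, map_mul, eval_X, eval_rename, hsome, eval_C, Option.elim_none, pderiv_C_mul]
  · rw [hsi, map_add, pderiv_rename hinj, pderiv_mul, pderiv_X_of_ne (Option.some_ne_none i).symm, zero_mul,
      zero_add, pderiv_rename hinj]
    simp only [map_add, map_mul, eval_X, eval_rename, hsome, eval_C, Option.elim_none, pderiv_C_mul]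
  · rw [hnone, eval_rename, hsome]
  · rw [hnone, pderiv_rename hinj, eval_rename, hsome]

/-- **The Rayleigh differences of `f = h + z_{none} g` at `(x, γ)`**:
`Δ_{some i, some j}(f)(x, γ) = Δᵢⱼ(h + γg)(x)` and `Δ_{some j, none}(f)(x, γ) = (∂ⱼh·g - h·∂ⱼg)(x)` (the two
displayed identities of the printed proof). [cite: Branden2007, §5 proof of Thm. 5.6] -/
theorem eval_rayleighDiff_optionElim {f : MvPolynomial (Option τ) ℝ} {h g : MvPolynomial τ ℝ}
    (hf : f = rename some h + X none * rename some g) (γ : ℝ) (x : τ → ℝ) :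
    (∀ i j, eval (fun o => Option.elim o γ x) (rayleighDiff (some i) (some j) f) =
      eval x (rayleighDiff i j (h + C γ * g))) ∧
    (∀ j, eval (fun o => Option.elim o γ x) (rayleighDiff (some j) none f) =
      eval x (pderiv j h * g - h * pderiv j g)) := by
  obtain ⟨h0, h1, h2, h3, h4⟩ := eval_optionElim_of_eq hf γ x
  constructor
  · intro i j
    simp only [rayleighDiff, map_sub, map_mul, h0, h1, h2]
  · intro j
    simp only [rayleighDiff, map_sub, map_mul, h1, h3, h4, h0]
    simp only [map_add, map_mul, eval_C, pderiv_C_mul]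
    ring

end Decomposition

/-! ## §4 Theorem 5.6 (1) ⇒ (2), and the discharge of the named fact -/

section Induction

/-- The leading coefficient of an everywhere nonnegative real quadratic is nonnegative. [folklore] -/
private theorem nonneg_of_forall_quadratic_nonneg {a b c : ℝ} (h : ∀ γ : ℝ, 0 ≤ a + b * γ + c * γ ^ 2) :
    0 ≤ c := by
  by_contra hc'
  have hc : c < 0 := not_le.1 hc'
  set γ : ℝ := (|a| + |b| + 1) / (-c) + 1 with hγ
  have hc' : 0 < -c := by linarith
  have hγ1 : 1 ≤ γ := by
    rw [hγ]
    have : 0 ≤ (|a| + |b| + 1) / (-c) := by positivity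
    linarith
  have hγc : |a| + |b| + 1 ≤ -c * γ := by
    rw [hγ, mul_add, mul_div_cancel₀ _ hc'.ne']
    nlinarith
  have key := h γ
  have h1 : a ≤ |a| * γ := (le_abs_self a).trans (le_mul_of_one_le_right (abs_nonneg a) hγ1)
  have h2 : b * γ ≤ |b| * γ := mul_le_mul_of_nonneg_right (le_abs_self b) (by linarith)
  nlinarith

/-- Transport of the three predicates along a renaming of variables by an equivalence. [folklore] -/
private theorem transport_equiv {α β : Type*} (e : α ≃ β) (f : MvPolynomial β ℝ) :
    (IsMultiAffine f → IsMultiAffine (rename e.symm f)) ∧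
    ((∀ (x : β → ℝ) (i j : β), 0 ≤ eval x (rayleighDiff i j f)) →
      ∀ (x : α → ℝ) (i j : α), 0 ≤ eval x (rayleighDiff i j (rename e.symm f))) ∧
    (rename e.symm f = 0 → f = 0) ∧ (IsRealStable (rename e.symm f) → IsRealStable f) := by
  have hinj : Function.Injective e.symm := e.symm.injective
  have hback : rename e (rename e.symm f) = f := by
    rw [rename_rename, e.self_comp_symm, rename_id, AlgHom.id_apply]
  refine ⟨fun hma i => ?_, fun hΔ x i j => ?_, fun h0 => ?_, fun hst => ?_⟩
  · have := degreeOf_rename_of_injective hinj (e i) (p := f)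
    rw [e.symm_apply_apply] at this
    rw [this]
    exact hma (e i)
  · have hi : pderiv i (rename e.symm f) = rename e.symm (pderiv (e i) f) := by
      conv_lhs => rw [← e.symm_apply_apply i]
      rw [pderiv_rename hinj]
    have hj : pderiv j (rename e.symm f) = rename e.symm (pderiv (e j) f) := by
      conv_lhs => rw [← e.symm_apply_apply j]
      rw [pderiv_rename hinj]
    have hij : pderiv i (pderiv j (rename e.symm f)) = rename e.symm (pderiv (e i) (pderiv (e j) f)) := by
      rw [hj]
      conv_lhs => rw [← e.symm_apply_apply i]
      rw [pderiv_rename hinj]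
    have : rayleighDiff i j (rename e.symm f) = rename e.symm (rayleighDiff (e i) (e j) f) := by
      rw [rayleighDiff, rayleighDiff, hij, hi, hj, map_sub, map_mul, map_mul]
    rw [this, eval_rename]
    exact hΔ _ _ _
  · rw [← hback, h0, map_zero]
  · have := hst.rename e
    rwa [← map_rename, hback] at this

/-- **Brändén 2007, Theorem 5.6, (1) ⇒ (2)**: a real multi-affine polynomial all of whose Rayleigh differences
`Δᵢⱼ(f) = ∂ᵢf·∂ⱼf - ∂ᵢ∂ⱼf·f` are nonnegative on all of `ℝⁿ` is real stable (or zero). Proof as printed: induction on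
the number of variables (`Fintype.induction_empty_option`), writing `f = h + z_{n+1} g`; the induction hypothesis makes
every `h + αg` real stable or zero (`Δᵢⱼ(f|_{z_{n+1}=α})(x) = Δᵢⱼ(f)(x, α) ≥ 0`) and also `g` (the leading
coefficient of the nonnegative quadratic `α ↦ Δᵢⱼ(h + αg)(x)`), the Wronskian condition is
`Δ_{j,n+1}(f)(x) ≥ 0`, and `eval_add_mul_eval_ne_zero` (Cor. 5.5 (c) ⇒ (b)) concludes.
[cite: Branden2007, §5 Thm. 5.6 ((1) ⇒ (2)) and its proof] -/
theorem eq_zero_or_isRealStable_of_rayleighDiff_nonneg (σ : Type*) [Fintype σ] (f : MvPolynomial σ ℝ)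
    (hma : IsMultiAffine f) (hΔ : ∀ (x : σ → ℝ) (i j : σ), 0 ≤ eval x (rayleighDiff i j f)) :
    f = 0 ∨ IsRealStable f := by
  revert f
  refine Fintype.induction_empty_option (P := fun α _ => ∀ f : MvPolynomial α ℝ, IsMultiAffine f →
    (∀ (x : α → ℝ) (i j : α), 0 ≤ eval x (rayleighDiff i j f)) → f = 0 ∨ IsRealStable f) ?_ ?_ ?_ σ
  · -- transport along an equivalence of variables
    intro α β _ e ih f hma hΔ
    obtain ⟨t1, t2, t3, t4⟩ := transport_equiv e f
    rcases ih (rename e.symm f) (t1 hma) (t2 hΔ) with h0 | hst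
    · exact Or.inl (t3 h0)
    · exact Or.inr (t4 hst)
  · -- no variables: `f` is a constant
    intro f _ _
    rw [eq_C_of_isEmpty f]
    by_cases h0 : coeff 0 f = 0
    · left
      rw [h0, C_0]
    · right
      intro z _
      rw [map_C, eval_C]
      exact (map_ne_zero_iff _ (algebraMap ℝ ℂ).injective).2 h0
  · -- the induction step `τ ↦ Option τ`
    intro τ _ ih f hma hΔ
    classical
    set P := optionEquivLeft ℝ τ f with hP
    set h := P.coeff 0 with hh
    set g := P.coeff 1 with hg
    have hdec : f = rename some h + X none * rename some g := eq_rename_add_X_mul_rename (hma none)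
    have hh_ma : IsMultiAffine h := isMultiAffine_coeff_optionEquivLeft hma 0
    have hg_ma : IsMultiAffine g := isMultiAffine_coeff_optionEquivLeft hma 1
    -- the pencil `h + γ g`
    have hpencil_ma : ∀ γ : ℝ, IsMultiAffine (h + C γ * g) := fun γ i =>
      (degreeOf_add_le i _ _).trans (max_le (hh_ma i) ((degreeOf_C_mul_le g i γ).trans (hg_ma i)))
    have hpencilΔ : ∀ (γ : ℝ) (x : τ → ℝ) (i j : τ), 0 ≤ eval x (rayleighDiff i j (h + C γ * g)) := by
      intro γ x i j
      rw [← (eval_rayleighDiff_optionElim hdec γ x).1 i j]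
      exact hΔ _ _ _
    have hpencil : ∀ γ : ℝ, h + C γ * g = 0 ∨ IsRealStable (h + C γ * g) := fun γ =>
      ih _ (hpencil_ma γ) (hpencilΔ γ)
    -- `g` is real stable or zero: `Δᵢⱼ(h + γg)(x)` is a nonnegative quadratic in `γ` with leading term `Δᵢⱼ(g)(x)`
    have hgΔ : ∀ (x : τ → ℝ) (i j : τ), 0 ≤ eval x (rayleighDiff i j g) := by
      intro x i j
      refine nonneg_of_forall_quadratic_nonneg (a := eval x (rayleighDiff i j h))
        (b := eval x (pderiv i h * pderiv j g + pderiv i g * pderiv j h -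
          pderiv i (pderiv j h) * g - pderiv i (pderiv j g) * h)) fun γ => ?_
      have := hpencilΔ γ x i j
      simp only [rayleighDiff, map_add, map_sub, map_mul, eval_C, pderiv_C_mul] at this ⊢
      nlinarith [this]
    have hg0 : g = 0 ∨ IsRealStable g := ih g hg_ma hgΔ
    -- `h = h + 0·g` is real stable or zero
    have hh0 : h = 0 ∨ IsRealStable h := by
      have := hpencil 0
      rwa [C_0, zero_mul, add_zero] at this
    -- the Wronskian condition
    have hW : ∀ (y : τ → ℝ) (j : τ), 0 ≤ eval y (pderiv j h * g - h * pderiv j g) := by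
      intro y j
      rw [← (eval_rayleighDiff_optionElim hdec 0 y).2 j]
      exact hΔ _ _ _
    -- evaluation of the complexification at `Z ∈ ℂ^{Option τ}`
    have heval : ∀ Z : Option τ → ℂ, eval Z (map (algebraMap ℝ ℂ) f) =
        eval (fun j => Z (some j)) (map (algebraMap ℝ ℂ) h) +
          Z none * eval (fun j => Z (some j)) (map (algebraMap ℝ ℂ) g) := by
      intro Z
      rw [hdec, map_add, map_mul, map_X, map_rename, map_rename, map_add, map_mul, eval_X, eval_rename,
        eval_rename]
      rfl
    rcases hh0 with hzero | hhst
    · -- `h = 0`: `f = z_{none} g`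
      rcases hg0 with hgz | hgst
      · left
        rw [hdec, hzero, hgz, map_zero, mul_zero, add_zero]
      · right
        intro Z hZ
        rw [heval Z, hzero, map_zero, map_zero, zero_add]
        exact mul_ne_zero (fun h0 => (hZ none).ne' (by rw [h0, Complex.zero_im]))
          (hgst _ fun j => hZ (some j))
    · right
      intro Z hZ
      rw [heval Z]
      exact eval_add_mul_eval_ne_zero hhst hg0 hpencil hW (fun j => hZ (some j)) (hZ none)

/-- **Brändén 2007, Theorem 5.6** — the named fact `Branden2007_multiAffine_rayleighDiff_nonneg_iff_realStable` of
`Basic.lean` holds: for a real multi-affine `f ≠ 0`, `Δᵢⱼ(f)(x) ≥ 0` for all `x ∈ ℝⁿ` and all `i, j` if and only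
if `f` is real stable. (2) ⇒ (1) is `rayleighDiff_nonneg_of_isRealStable`; (1) ⇒ (2) is
`eq_zero_or_isRealStable_of_rayleighDiff_nonneg`. [cite: Branden2007, §5 Thm. 5.6] -/
theorem Branden2007_multiAffine_rayleighDiff_nonneg_iff_realStable_holds :
    Branden2007_multiAffine_rayleighDiff_nonneg_iff_realStable := by
  intro σ _ f hma hf0
  constructor
  · intro hΔ
    exact (eq_zero_or_isRealStable_of_rayleighDiff_nonneg σ f hma hΔ).resolve_left hf0
  · intro hst x i j
    classical
    exact rayleighDiff_nonneg_of_isRealStable hma hst x i j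

end Induction

end Literature.Combinatorics.StablePolynomials

end
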